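import Summits.QuantumFields.BalabanUV.Beta.GAN24.WoodburyFibreBoxQGQ
import Summits.QuantumFields.BalabanUV.Beta.GAN24.WoodburyFibreGaugeCubeDecay
import Literature.MathematicalPhysics.QuantumFieldTheory.Balaban1983to89.B4Thm110ZeroBox

/-!
# Beta / GAN24 / WoodburyFibreGaugeInputs — census row V9 part 2: the SCALAR INPUTS of the gauge-section assembly IN ONE
TYPING, on Bałaban's Neumann boxes at `A = 0`, for EVERY block side `n` (all scales): cube decay of the hard fluctuation
covariance `Γ = flucCov`, entrywise and column-cube decay of the minimiser `ℋ = G Q*(QGQ*)⁻¹`, from the tree theorem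
B4 (1.10) (`B4Thm110ZeroBox`) and the box coercivity `GAN24/WoodburyFibreBoxQGQ` BY NAME

Cell `pub-balaban`, β sub-cell, BINDER ROW **G-an2-4 ∕ (CONV-C)** («NOT IN PRINT; our proof attempt»), prover part **P3 =
WOODBURY-FIBRE reduction** (lineage `b2b-balaban-gan24-p3`, gen 6).  HONEST FRAMING (verbatim): discharging `BetaPertH`
makes Bałaban's UV stability UNCONDITIONAL — a real constructive-QFT result; it is NOT the continuum limit and NOT the Clay
problem.  HONEST DEPENDENCY: continuum YM on T⁴ ⇐ BetaPertH ∧ nine spine estimates (0/9 proved); BetaPertH ⇐ (D1) ∧ (D4) ∧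
CAP+tail; G-an2-4 gates asym, D1 and NE2/3/4.  `[folklore]` bookkeeping over tree theorems; 0 sorry; nothing printed and
nothing programme-internal is used as a hypothesis; nothing of (CONV-C) ∕ `BetaPertH` is discharged here.

## The typing (one Neumann box `X = Π_μ[0, n·M_μ)` of unit blocks `□ = Π_μ[0, M_μ)`, `A = 0`)

* fine index `ι = ↥(boxDom (fineN n M))`, block index `κ = ↥(boxDom M)`, `blkBox : ι → κ` (`GAN24/WoodburyFibreBoxQGQ`),
  positions `σ = id` on `κ`, distance `rho M` = sup-distance of block labels (`B4BoxCov237.rho`), block profile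
  `K = B4Sect5Proof.latticeConst (d+1)` (`posProfile_rho`, from `B4BoxCov237.rho_sumBound`);
* `G = (boxOpR n a m² M)⁻¹` (B4 (2.44) in lattice units), `S = indB n M` (0∕1 block incidence, `Q_k = n^{−(d+1)}S`,
  `Q_k^* = Sᵀ`), and the UNITARY normalisation `Qn n M = n^{−(d+1)/2}·S` (`QnQnᴴ = 1`), for which
  `boxOpR n a m² M = boxOpR n 0 m² M + Qnᴴ(a·1)Qn` (`boxOpR_eq_reg`) — R17's `L + QᴴTQ` with `L = n²(−Δ^N_X) + m²`,
  `T = a·1`; the fibre objects `pivot ∕ minimiser ∕ flucCov` of `Beta/PropagatorWoodburyFibre` at `(boxOpR n a m² M, Qn)`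
  are Bałaban's `Q_kG_kQ_k^*` (= `pivot`, `pivot_eq`), `H_k(□) = GQ_k^*(Q_kG_kQ_k^*)⁻¹ = n^{(d+1)/2}·minimiser`
  (`minimiser_eq`), and the hard fluctuation covariance `Γ_k(□) = G − H_kQ_kG` (= `flucCov`, normalisation-free).

## Results (all constants explicit in the scalar data `(cG, δ)` = cube decay of `G`, `γ` = coercivity of `Q_kG_kQ_k^*`,
and the profile `K`; NO dependence on `n`, `M` beyond these)

* `cubeDecay_of_roww` + **`cubeDecay_boxGreen`**: B4 (1.10)'s weighted row bound (`thm110_zero_box_roww_coeff`, all `k ≥ 1`)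
  ⇒ `CubeDecay (rho M) blkBox id G_k(□) (c₀e^{δ₀}) δ₀` for every scale, box and window — input (i) of R20;
* `posDecay_G_indBT`, `colCube_G_indBT`, `posDecay_pivot`: the legs `GSᵀ`, `SGSᵀ` from the cube decay of `G` alone;
* §4 `ColCubeDecay.mono`, `ColCubeDecay.smul`, `colCubeDecay_mul_posDecay` (complements to R20's composition lemmas);
* §5 the normalisation `Qn`: `Qn_mul_conjTranspose` (`QnQnᴴ = 1`), `reg_eq`, `boxOpR_eq_reg`, `pivot_eq` (`pivot = Q_kG_kQ_k^*`),
  `minimiser_eq`, `flucCov_eq_sub`, `conjTranspose_G_QnT`, `gram_coercive_one` (`(QnQnᴴ)⁻¹ = 1`, so `ℋ̃ᴴℋ̃ ⪰ 1`), `isUnit_gram`.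
The derived decays of `ℋ̃`, `Γ` are `GAN24/WoodburyFibreGaugeBox`; THE END (R20, all scales) is `GAN24/WoodburyFibreLandauBox`.
-/

namespace Summit.QuantumFields.BalabanUV.Beta.GAN24.WoodburyFibreGaugeInputs

open Finset Matrix
open Literature.MathematicalPhysics.QuantumFieldTheory.Balaban1983to89
open B4ContourShift (supNorm supNorm_nonneg abs_le_supNorm exists_supNorm_eq)
open B4Reflection242 (boxDom blk blk_mem_boxDom)
open B4BoxCov237 (boxOpR indB rho rho_isPseudoDist rho_sumBound boxOpR_isSymm boxOpR_isUnit boxOpR_inv_isSymm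
  indB_mul_mul_transpose_apply card_filter_blk)
open B4Sect5Torus (IsPseudoDist rate rate_pos rate_le_quarter)
open B4Sect5Proof (latticeConst latticeConst_nonneg)
open B5Decay126 (PosDecay PosProfile)
open Summit.QuantumFields.BalabanUV.Beta.PropagatorWoodburyFibre (pivot effForm minimiser flucCov)
open WoodburyFibreGaugeCubeDecay (CubeDecay ColCubeDecay)
open WoodburyFibreBoxQGQ (fineN blkBox blkBox_val indB_apply card_fibre_blkBox boxOpR_eq_add_gram sGs_coercive)

noncomputable section

variable {d : ℕ}

/-! ## §1 Geometry of the block labels: profile, and fine distance versus block distance -/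

/-- the uniform block profile: `Σ_b e^{−t·rho(y, b)} ≤ K_{d+1}(t)` for every base label `y`. [folklore] -/
theorem posProfile_rho (M : Fin (d + 1) → ℕ) : PosProfile (rho M) id (latticeConst (d + 1)) :=
  fun t ht y => rho_sumBound M t ht y

/-- the profile is nonnegative at positive rates. [folklore] -/
theorem latticeConst_nonneg' (d : ℕ) : ∀ t : ℝ, 0 < t → 0 ≤ latticeConst (d + 1) t :=
  fun _ ht => latticeConst_nonneg _ ht.le

/-- **FINE DISTANCE CONTROLS BLOCK DISTANCE**: `n·rho(blk x, blk x′) ≤ |x − x′|_∞ + (n − 1)`. [folklore] -/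
theorem rho_blkBox_le {n : ℕ} (hn : 1 ≤ n) (M : Fin (d + 1) → ℕ) (x x' : ↥(boxDom (fineN n M))) :
    (n : ℝ) * rho M (blkBox hn M x) (blkBox hn M x') ≤ supNorm (x.1 - x'.1) + ((n : ℝ) - 1) := by
  obtain ⟨i, hi⟩ := exists_supNorm_eq ((blkBox hn M x).1 - (blkBox hn M x').1)
  unfold rho
  rw [hi]
  have hn0 : (0 : ℤ) < n := by exact_mod_cast hn
  have hxi := abs_le_supNorm (x.1 - x'.1) i
  simp only [Pi.sub_apply, blkBox_val, B4Reflection242.blk] at hxi ⊢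
  set u := x.1 i
  set v := x'.1 i
  have h1 : u % (n : ℤ) + u / (n : ℤ) * n = u := Int.emod_add_ediv_mul u n
  have h2 : v % (n : ℤ) + v / (n : ℤ) * n = v := Int.emod_add_ediv_mul v n
  have h3 : 0 ≤ u % n := Int.emod_nonneg u hn0.ne'
  have h4 : u % n < n := Int.emod_lt_of_pos u hn0
  have h5 : 0 ≤ v % n := Int.emod_nonneg v hn0.ne'
  have h6 : v % n < n := Int.emod_lt_of_pos v hn0
  have h7 : (n : ℤ) * |u / n - v / n| ≤ |u - v| + (n - 1) := by
    rw [← abs_of_pos hn0, ← abs_mul, abs_of_pos hn0]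
    have e : (n : ℤ) * (u / n - v / n) = (u - v) - (u % n - v % n) := by linear_combination h1 - h2
    rw [e]
    have hrr : |u % (n : ℤ) - v % n| ≤ n - 1 := abs_le.2 ⟨by linarith, by linarith⟩
    calc |u - v - (u % ↑n - v % ↑n)| ≤ |u - v| + |u % ↑n - v % ↑n| := abs_sub _ _
      _ ≤ _ := by linarith
  have h8 : ((n : ℤ) : ℝ) * (((|u / n - v / n| : ℤ)) : ℝ) ≤ (((|u - v| : ℤ)) : ℝ) + ((n : ℝ) - 1) := by
    exact_mod_cast h7
  push_cast at h8 hxi ⊢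
  linarith

/-! ## §2 From B4 (1.10)'s weighted row bound to the cube currency -/

/-- **WEIGHTED ROW BOUND ⇒ CUBE DECAY IN BLOCK UNITS**: if `Σ_{x′} |G(x,x′)|·e^{δ₀|x−x′|_∞/n} ≤ c₀` for every row, then
every row of `G` summed over the block `b′` is `≤ c₀e^{δ₀}·e^{−δ₀·rho(blk x, b′)}`. [folklore] -/
theorem cubeDecay_of_roww {n : ℕ} (hn : 1 ≤ n) {M : Fin (d + 1) → ℕ}
    (G : Matrix ↥(boxDom (fineN n M)) ↥(boxDom (fineN n M)) ℝ) {δ₀ c₀ : ℝ} (hδ : 0 ≤ δ₀) (hc : 0 ≤ c₀)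
    (h : ∀ x, ∑ x', |G x x'| * Real.exp (δ₀ * supNorm (x.1 - x'.1) / n) ≤ c₀) :
    CubeDecay (rho M) (blkBox hn M) id G (c₀ * Real.exp δ₀) δ₀ := by
  refine ⟨by positivity, fun x b' => ?_⟩
  have hn0 : (0 : ℝ) < n := by exact_mod_cast hn
  set E := Real.exp (-(δ₀ * rho M (id (blkBox hn M x)) (id b'))) with hE
  have hpt : ∀ y ∈ Finset.univ.filter (fun y => blkBox hn M y = b'),
      |G x y| ≤ |G x y| * Real.exp (δ₀ * supNorm (x.1 - y.1) / n) * (Real.exp δ₀ * E) := by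
    intro y hy
    have hyb : blkBox hn M y = b' := (Finset.mem_filter.1 hy).2
    have hρ := rho_blkBox_le hn M x y
    rw [hyb] at hρ
    have h1 : 1 ≤ Real.exp (δ₀ * supNorm (x.1 - y.1) / n) * (Real.exp δ₀ * E) := by
      rw [hE, ← Real.exp_add, ← Real.exp_add]
      apply Real.one_le_exp
      simp only [id]
      have h1 : rho M (blkBox hn M x) b' ≤ supNorm (x.1 - y.1) / n + 1 := by
        rw [div_add_one hn0.ne', le_div_iff₀ hn0]; linarith
      have h2 : δ₀ * rho M (blkBox hn M x) b' ≤ δ₀ * (supNorm (x.1 - y.1) / n + 1) := mul_le_mul_of_nonneg_left h1 hδ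
      have h3 : δ₀ * (supNorm (x.1 - y.1) / n + 1) = δ₀ * supNorm (x.1 - y.1) / n + δ₀ := by ring
      linarith
    calc |G x y| = |G x y| * 1 := (mul_one _).symm
      _ ≤ _ := by rw [mul_assoc]; exact mul_le_mul_of_nonneg_left h1 (abs_nonneg _)
  calc ∑ y ∈ Finset.univ.filter (fun y => blkBox hn M y = b'), |G x y|
      ≤ ∑ y ∈ Finset.univ.filter (fun y => blkBox hn M y = b'),
          |G x y| * Real.exp (δ₀ * supNorm (x.1 - y.1) / n) * (Real.exp δ₀ * E) := Finset.sum_le_sum hpt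
    _ = (∑ y ∈ Finset.univ.filter (fun y => blkBox hn M y = b'),
          |G x y| * Real.exp (δ₀ * supNorm (x.1 - y.1) / n)) * (Real.exp δ₀ * E) := by rw [Finset.sum_mul]
    _ ≤ (∑ y, |G x y| * Real.exp (δ₀ * supNorm (x.1 - y.1) / n)) * (Real.exp δ₀ * E) := by
        refine mul_le_mul_of_nonneg_right ?_ (by positivity)
        exact Finset.sum_le_univ_sum_of_nonneg fun y => by positivity
    _ ≤ c₀ * (Real.exp δ₀ * E) := mul_le_mul_of_nonneg_right (h x) (by positivity)
    _ = c₀ * Real.exp δ₀ * E := by ring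

/-- **B4 (1.10) IN THE CUBE CURRENCY, ALL SCALES**: for every dimension `d+1`, block size `L = ℓ+1 ≥ 2` and window
`a ∈ [a₋, a₊]` (`a₋ > 0`), `m² ∈ [0, m²₊]` there are `δ₀, c₀ > 0` such that for EVERY `k ≥ 1` (`n = L^k`), every
`(a, m²)` in the window and every box of unit blocks, `G_k(□) = (boxOpR (L^k) a m² M)⁻¹` has block row sums
`Σ_{y ∈ b′}|G(x,y)| ≤ c₀·e^{−δ₀·rho(blk x, b′)}` — `B4Thm110ZeroBox.thm110_zero_box_roww_coeff` BY NAME, read through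
`cubeDecay_of_roww`. [folklore] -/
theorem cubeDecay_boxGreen (d ℓ : ℕ) (hℓ : 1 ≤ ℓ) (amin aplus m2plus : ℝ) (ha : 0 < amin) :
    ∃ δ₀ c₀ : ℝ, 0 < δ₀ ∧ 0 < c₀ ∧ ∀ (k : ℕ) (hk : 1 ≤ k), ∀ (a m2 : ℝ), amin ≤ a → a ≤ aplus → 0 ≤ m2 → m2 ≤ m2plus →
      ∀ (M : Fin (d + 1) → ℕ), (∀ i, 1 ≤ M i) →
        CubeDecay (rho M) (blkBox (Nat.one_le_pow k (ℓ + 1) (Nat.succ_pos ℓ)) M) id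
          ((boxOpR ((ℓ + 1) ^ k) a m2 M)⁻¹) c₀ δ₀ := by
  obtain ⟨δ₀, c₀, hδ, hc, h⟩ := B4Thm110ZeroBox.thm110_zero_box_roww_coeff d ℓ hℓ amin aplus m2plus ha
  refine ⟨δ₀, c₀ * Real.exp δ₀, hδ, by positivity, fun k hk a m2 h1 h2 h3 h4 M hM => ?_⟩
  refine cubeDecay_of_roww _ _ hδ.le hc.le fun x => ?_
  have := h k hk a m2 h1 h2 h3 h4 M hM x
  simpa using this

/-! ## §3 Legs built from the cube decay of `G` alone -/

section Legs

variable {n : ℕ} (hn : 1 ≤ n) (M : Fin (d + 1) → ℕ)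
variable {G : Matrix ↥(boxDom (fineN n M)) ↥(boxDom (fineN n M)) ℝ} {cG δ : ℝ}

/-- `(G·Sᵀ)(x, b) = Σ_{y ∈ b} G(x, y)`. [folklore] -/
theorem mul_indBT_apply (x : ↥(boxDom (fineN n M))) (b : ↥(boxDom M)) :
    (G * (indB n M)ᵀ) x b = ∑ y ∈ Finset.univ.filter (fun y => blkBox hn M y = b), G x y := by
  rw [Matrix.mul_apply, Finset.sum_filter]
  refine Finset.sum_congr rfl fun y _ => ?_
  rw [Matrix.transpose_apply, indB_apply hn]
  split_ifs <;> simp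

/-- **leg `GSᵀ`, entrywise**: `|(GSᵀ)(x,b)| ≤ cG·e^{−δ·rho(blk x, b)}`. [folklore] -/
theorem posDecay_G_indBT (hG : CubeDecay (rho M) (blkBox hn M) id G cG δ) :
    PosDecay (rho M) (id ∘ blkBox hn M) id (G * (indB n M)ᵀ) cG δ := by
  refine ⟨hG.1, fun x b => ?_⟩
  rw [mul_indBT_apply hn]
  exact (Finset.abs_sum_le_sum_abs _ _).trans (hG.2 x b)

/-- **leg `GSᵀ`, column cube sums**: `Σ_{y ∈ b′} |(GSᵀ)(y,b)| ≤ n^{d+1}·cG·e^{−δ·rho(b′, b)}`. [folklore] -/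
theorem colCube_G_indBT (hG : CubeDecay (rho M) (blkBox hn M) id G cG δ) :
    ColCubeDecay (rho M) (blkBox hn M) id (G * (indB n M)ᵀ) ((n : ℝ) ^ (d + 1) * cG) δ := by
  refine ⟨mul_nonneg (by positivity) hG.1, fun b b' => ?_⟩
  calc ∑ y ∈ Finset.univ.filter (fun y => blkBox hn M y = b'), |(G * (indB n M)ᵀ) y b|
      ≤ ∑ y ∈ Finset.univ.filter (fun y => blkBox hn M y = b'), cG * Real.exp (-(δ * rho M (id b') (id b))) := by
        refine Finset.sum_le_sum fun y hy => ?_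
        have hyb : blkBox hn M y = b' := (Finset.mem_filter.1 hy).2
        rw [mul_indBT_apply hn]
        have := hG.2 y b
        rw [hyb] at this
        exact (Finset.abs_sum_le_sum_abs _ _).trans this
    _ = (n : ℝ) ^ (d + 1) * cG * Real.exp (-(δ * rho M (id b') (id b))) := by
        rw [Finset.sum_const, nsmul_eq_mul, card_fibre_blkBox hn M b']; push_cast; ring

/-- **the pivot `SGSᵀ`, entrywise**: `|(SGSᵀ)(b,b′)| ≤ n^{d+1}·cG·e^{−δ·rho(b, b′)}`. [folklore] -/
theorem posDecay_pivot (hG : CubeDecay (rho M) (blkBox hn M) id G cG δ) :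
    PosDecay (rho M) id id (indB n M * G * (indB n M)ᵀ) ((n : ℝ) ^ (d + 1) * cG) δ := by
  refine ⟨mul_nonneg (by positivity) hG.1, fun b b' => ?_⟩
  rw [indB_mul_mul_transpose_apply]
  have hset : ∀ bb : ↥(boxDom M), (Finset.univ.filter fun x : ↥(boxDom (fun i => n * M i)) => blk n x.1 = bb.1)
      = Finset.univ.filter fun x : ↥(boxDom (fineN n M)) => blkBox hn M x = bb := by
    intro bb; ext x; simp only [Finset.mem_filter, Finset.mem_univ, true_and, Subtype.ext_iff, blkBox_val]
  rw [hset b, hset b']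
  calc |∑ x ∈ Finset.univ.filter (fun x => blkBox hn M x = b), ∑ x' ∈ Finset.univ.filter (fun x' => blkBox hn M x' = b'), G x x'|
      ≤ ∑ x ∈ Finset.univ.filter (fun x => blkBox hn M x = b), |∑ x' ∈ Finset.univ.filter (fun x' => blkBox hn M x' = b'), G x x'| :=
        Finset.abs_sum_le_sum_abs _ _
    _ ≤ ∑ x ∈ Finset.univ.filter (fun x => blkBox hn M x = b), cG * Real.exp (-(δ * rho M (id b) (id b'))) := by
        refine Finset.sum_le_sum fun x hx => ?_
        have hxb : blkBox hn M x = b := (Finset.mem_filter.1 hx).2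
        have := hG.2 x b'
        rw [hxb] at this
        exact (Finset.abs_sum_le_sum_abs _ _).trans this
    _ = (n : ℝ) ^ (d + 1) * cG * Real.exp (-(δ * rho M (id b) (id b'))) := by
        rw [Finset.sum_const, nsmul_eq_mul, card_fibre_blkBox hn M b]; push_cast; ring

end Legs

/-! ## §4 Two generic compositions in the column-cube currency (complements to `GAN24/WoodburyFibreGaugeCubeDecay` §2) -/

section Generic

variable {X : Type*} {dX : X → X → ℝ}
variable {ι κ : Type*} [Fintype ι] [Fintype κ] [DecidableEq κ]
variable {blk : ι → κ} {σ : κ → X} {K : ℝ → ℝ}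

omit [Fintype κ] in
/-- weakening the rate of a column-cube decay. [folklore] -/
theorem ColCubeDecay.mono (hd : IsPseudoDist dX) {H : Matrix ι κ ℝ} {c δ δ' : ℝ} (h : ColCubeDecay dX blk σ H c δ)
    (hδ' : δ' ≤ δ) : ColCubeDecay dX blk σ H c δ' := by
  refine ⟨h.1, fun b b' => (h.2 b b').trans (mul_le_mul_of_nonneg_left ?_ h.1)⟩
  exact Real.exp_le_exp.mpr (by nlinarith [hd.nonneg (σ b') (σ b)])

omit [Fintype κ] in
/-- scalar multiples in the column-cube currency. [folklore] -/
theorem ColCubeDecay.smul {H : Matrix ι κ ℝ} {c δ : ℝ} (h : ColCubeDecay dX blk σ H c δ) (t : ℝ) :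
    ColCubeDecay dX blk σ (t • H) (|t| * c) δ := by
  refine ⟨mul_nonneg (abs_nonneg t) h.1, fun b b' => ?_⟩
  calc ∑ y ∈ Finset.univ.filter (fun y => blk y = b'), |(t • H) y b|
      = |t| * ∑ y ∈ Finset.univ.filter (fun y => blk y = b'), |H y b| := by
        rw [Finset.mul_sum]; exact Finset.sum_congr rfl fun y _ => by rw [Matrix.smul_apply, smul_eq_mul, abs_mul]
    _ ≤ |t| * (c * Real.exp (-(δ * dX (σ b') (σ b)))) := mul_le_mul_of_nonneg_left (h.2 b b') (abs_nonneg t)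
    _ = _ := by ring

/-- **(fine × block, column-cube) · (block × block, entrywise)**: `ColCubeDecay T ∧ PosDecay B ⇒ ColCubeDecay (T·B)`
with constant `c₁c₂K(g)` (triangle inequality + the block profile at the base point `σ b′`). [folklore] -/
theorem colCubeDecay_mul_posDecay (hd : IsPseudoDist dX) (hK0 : ∀ t, 0 < t → 0 ≤ K t) (hK : PosProfile dX σ K)
    {T : Matrix ι κ ℝ} {B : Matrix κ κ ℝ} {c₁ c₂ δa δb : ℝ} (hT : ColCubeDecay dX blk σ T c₁ δa)
    (hB : PosDecay dX σ σ B c₂ δb) {δ' g : ℝ} (hδ' : 0 ≤ δ') (hg : 0 < g) (hga : δ' + g ≤ δa) (hgb : δ' + g ≤ δb) :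
    ColCubeDecay dX blk σ (T * B) (c₁ * c₂ * K g) δ' := by
  refine ⟨mul_nonneg (mul_nonneg hT.1 hB.1) (hK0 g hg), fun b b' => ?_⟩
  set E : ℝ := Real.exp (-(δ' * dX (σ b') (σ b))) with hE
  have step1 : ∑ y ∈ Finset.univ.filter (fun y => blk y = b'), |(T * B) y b|
      ≤ ∑ b'', (∑ y ∈ Finset.univ.filter (fun y => blk y = b'), |T y b''|) * |B b'' b| := by
    calc ∑ y ∈ Finset.univ.filter (fun y => blk y = b'), |(T * B) y b|
        ≤ ∑ y ∈ Finset.univ.filter (fun y => blk y = b'), ∑ b'', |T y b''| * |B b'' b| :=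
          Finset.sum_le_sum fun y _ => by
            rw [Matrix.mul_apply]
            exact (Finset.abs_sum_le_sum_abs _ _).trans (le_of_eq (Finset.sum_congr rfl fun z _ => abs_mul _ _))
      _ = ∑ b'', (∑ y ∈ Finset.univ.filter (fun y => blk y = b'), |T y b''|) * |B b'' b| := by
          rw [Finset.sum_comm]; exact Finset.sum_congr rfl fun b'' _ => by rw [Finset.sum_mul]
  have step2 : ∑ b'', (∑ y ∈ Finset.univ.filter (fun y => blk y = b'), |T y b''|) * |B b'' b|
      ≤ ∑ b'', c₁ * c₂ * E * Real.exp (-(g * dX (σ b') (σ b''))) := by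
    refine Finset.sum_le_sum fun b'' _ => ?_
    calc (∑ y ∈ Finset.univ.filter (fun y => blk y = b'), |T y b''|) * |B b'' b|
        ≤ (c₁ * Real.exp (-(δa * dX (σ b') (σ b'')))) * (c₂ * Real.exp (-(δb * dX (σ b'') (σ b)))) :=
          mul_le_mul (hT.2 b'' b') (hB.2 b'' b) (abs_nonneg _) (mul_nonneg hT.1 (Real.exp_pos _).le)
      _ = c₁ * c₂ * (Real.exp (-(δa * dX (σ b') (σ b''))) * Real.exp (-(δb * dX (σ b'') (σ b)))) := by ring
      _ ≤ c₁ * c₂ * (E * Real.exp (-(g * dX (σ b') (σ b'')))) :=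
          mul_le_mul_of_nonneg_left (WoodburyFibreGaugeCubeDecay.exp_two_legs (hd.nonneg _ _) (hd.nonneg _ _)
            (hd.triangle _ _ _) hδ' hg hga hgb) (mul_nonneg hT.1 hB.1)
      _ = _ := by ring
  have step3 : ∑ b'', c₁ * c₂ * E * Real.exp (-(g * dX (σ b') (σ b''))) ≤ c₁ * c₂ * E * K g := by
    rw [← Finset.mul_sum]
    exact mul_le_mul_of_nonneg_left (hK g hg (σ b')) (mul_nonneg (mul_nonneg hT.1 hB.1) (Real.exp_pos _).le)
  calc _ ≤ _ := step1
    _ ≤ _ := step2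
    _ ≤ c₁ * c₂ * E * K g := step3
    _ = c₁ * c₂ * K g * E := by ring

end Generic

/-! ## §5 The unitary normalisation `Qn = n^{−(d+1)/2}·S` and the fibre objects at `(boxOpR n a m² M, Qn)` -/

section Normalised

variable {n : ℕ} (M : Fin (d + 1) → ℕ)

/-- the normalising scalar `s = (√(n^{d+1}))⁻¹`. [folklore] -/
def sN (d n : ℕ) : ℝ := (Real.sqrt ((n : ℝ) ^ (d + 1)))⁻¹

/-- `0 < s`. [folklore] -/
theorem sN_pos (hn : 1 ≤ n) : 0 < sN d n := by
  have hn0 : (0 : ℝ) < n := by exact_mod_cast hn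
  unfold sN; positivity

/-- `s·s·n^{d+1} = 1`. [folklore] -/
theorem sN_mul_sN_mul (hn : 1 ≤ n) : sN d n * sN d n * (n : ℝ) ^ (d + 1) = 1 := by
  have hn0 : (0 : ℝ) < n := by exact_mod_cast hn
  have hN : (0 : ℝ) < (n : ℝ) ^ (d + 1) := by positivity
  have hs : Real.sqrt ((n : ℝ) ^ (d + 1)) * Real.sqrt ((n : ℝ) ^ (d + 1)) = (n : ℝ) ^ (d + 1) :=
    Real.mul_self_sqrt hN.le
  have hsq : 0 < Real.sqrt ((n : ℝ) ^ (d + 1)) := Real.sqrt_pos.2 hN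
  unfold sN
  field_simp
  linarith [hs]

/-- `s·s = (n^{d+1})⁻¹`. [folklore] -/
theorem sN_mul_sN (hn : 1 ≤ n) : sN d n * sN d n = ((n : ℝ) ^ (d + 1))⁻¹ :=
  eq_inv_of_mul_eq_one_left (sN_mul_sN_mul hn)

/-- **the unitary normalisation of the block-incidence matrix**, `Qn = (√(n^{d+1}))⁻¹·indB`. [folklore] -/
def Qn (n : ℕ) (M : Fin (d + 1) → ℕ) : Matrix ↥(boxDom M) ↥(boxDom (fineN n M)) ℝ := sN d n • indB n M

/-- `Qnᴴ = s·indBᵀ` (real entries). [folklore] -/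
theorem Qn_conjTranspose : (Qn n M)ᴴ = sN d n • (indB n M)ᵀ := by
  rw [Qn, Matrix.conjTranspose_smul, Matrix.conjTranspose_eq_transpose_of_trivial]
  rfl

/-- `S·Sᵀ = n^{d+1}·1` (each block has `n^{d+1}` fine points). [folklore] -/
theorem indB_mul_transpose (hn : 1 ≤ n) : indB n M * (indB n M)ᵀ = ((n : ℝ) ^ (d + 1)) • (1 : Matrix ↥(boxDom M) ↥(boxDom M) ℝ) := by
  ext y y'
  rw [Matrix.mul_apply, Matrix.smul_apply, smul_eq_mul]
  by_cases hyy : y = y'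
  · subst hyy
    rw [Matrix.one_apply_eq, mul_one]
    have : ∀ x, indB n M y x * (indB n M)ᵀ x y = if blkBox hn M x = y then 1 else 0 := by
      intro x; rw [Matrix.transpose_apply, indB_apply hn]; split_ifs <;> simp
    simp_rw [this]
    rw [Finset.sum_boole, card_fibre_blkBox hn M y]; push_cast; ring
  · rw [Matrix.one_apply_ne hyy, mul_zero]
    apply Finset.sum_eq_zero
    intro x _
    rw [Matrix.transpose_apply, indB_apply hn, indB_apply hn]
    by_cases h1 : blkBox hn M x = y
    · simp [h1, hyy]
    · simp [h1]

/-- **`Qn·Qnᴴ = 1`**. [folklore] -/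
theorem Qn_mul_conjTranspose (hn : 1 ≤ n) : Qn n M * (Qn n M)ᴴ = 1 := by
  rw [Qn_conjTranspose, Qn, Matrix.smul_mul, Matrix.mul_smul, indB_mul_transpose M hn, smul_smul, smul_smul,
    sN_mul_sN_mul hn, one_smul]

/-- the regulariser: `Qnᴴ·(a·1)·Qn = (a/n^{d+1})·SᵀS`. [folklore] -/
theorem reg_eq (hn : 1 ≤ n) (a : ℝ) : (Qn n M)ᴴ * (a • (1 : Matrix ↥(boxDom M) ↥(boxDom M) ℝ)) * Qn n M
    = (a * (((n : ℝ)) ^ (d + 1))⁻¹) • ((indB n M)ᵀ * indB n M) := by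
  rw [Qn_conjTranspose]
  simp only [Qn, Matrix.mul_smul, Matrix.smul_mul, Matrix.mul_one, smul_smul]
  rw [← sN_mul_sN hn]
  congr 1; ring

/-- **R17's shape**: `boxOpR n a m² M = L + QnᴴTQn` with `L = boxOpR n 0 m² M` (`= n²(−Δ^N_X) + m²`), `T = a·1`. [folklore] -/
theorem boxOpR_eq_reg (hn : 1 ≤ n) (a m2 : ℝ) :
    boxOpR n a m2 M = boxOpR n 0 m2 M + (Qn n M)ᴴ * (a • (1 : Matrix ↥(boxDom M) ↥(boxDom M) ℝ)) * Qn n M := by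
  rw [reg_eq M hn, boxOpR_eq_add_gram hn]

/-- `L = boxOpR n 0 m² M` is Hermitian (real symmetric). [folklore] -/
theorem boxOpR_conjTranspose (a m2 : ℝ) : (boxOpR n a m2 M)ᴴ = boxOpR n a m2 M := by
  rw [Matrix.conjTranspose_eq_transpose_of_trivial]; exact boxOpR_isSymm n a m2 M

/-- **the pivot is Bałaban's `Q_kG_kQ_k^*`**: `pivot (boxOpR n a m² M) Qn = n^{−(d+1)}·S·G·Sᵀ`. [folklore] -/
theorem pivot_eq (hn : 1 ≤ n) (a m2 : ℝ) : pivot (boxOpR n a m2 M) (Qn n M)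
    = (((n : ℝ) ^ (d + 1))⁻¹) • (indB n M * (boxOpR n a m2 M)⁻¹ * (indB n M)ᵀ) := by
  rw [pivot, Qn_conjTranspose]
  simp only [Qn, Matrix.smul_mul, Matrix.mul_smul, smul_smul]
  rw [sN_mul_sN hn]

/-- the minimiser as a product: `ℋ̃ = (G·Qnᴴ)·(pivot)⁻¹`. [folklore] -/
theorem minimiser_eq (a m2 : ℝ) : minimiser (boxOpR n a m2 M) (Qn n M)
    = ((boxOpR n a m2 M)⁻¹ * (Qn n M)ᴴ) * (pivot (boxOpR n a m2 M) (Qn n M))⁻¹ := rfl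

/-- `flucCov H Q = H⁻¹ − (minimiser H Q)·Q·H⁻¹` (generic). [folklore] -/
theorem flucCov_eq_sub {𝕜 : Type*} [Field 𝕜] [StarRing 𝕜] {p q : Type*} [Fintype p] [Fintype q] [DecidableEq p]
    [DecidableEq q] (H : Matrix q q 𝕜) (Q : Matrix p q 𝕜) : flucCov H Q = H⁻¹ - minimiser H Q * Q * H⁻¹ := by
  simp only [flucCov, minimiser, Matrix.mul_assoc]

/-- `(G·Qnᴴ)ᴴ = Qn·G` (`G` is symmetric). [folklore] -/
theorem conjTranspose_G_QnT (a m2 : ℝ) : ((boxOpR n a m2 M)⁻¹ * (Qn n M)ᴴ)ᴴ = Qn n M * (boxOpR n a m2 M)⁻¹ := by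
  rw [Matrix.conjTranspose_mul, Matrix.conjTranspose_conjTranspose, Matrix.conjTranspose_eq_transpose_of_trivial]
  have h : ((boxOpR n a m2 M)⁻¹)ᵀ = (boxOpR n a m2 M)⁻¹ := boxOpR_inv_isSymm n a m2 M
  rw [h]

/-- `(QnQnᴴ)⁻¹ = 1`, hence it is coercive with constant `1` (the capacitance input of R20). [folklore] -/
theorem gram_coercive_one (hn : 1 ≤ n) : QGQInverse.Coercive (Qn n M * (Qn n M)ᴴ)⁻¹ 1 := by
  intro x; rw [Qn_mul_conjTranspose M hn, inv_one, Matrix.one_mulVec, one_mul]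

/-- `QnQnᴴ` is a unit. [folklore] -/
theorem isUnit_gram (hn : 1 ≤ n) : IsUnit (Qn n M * (Qn n M)ᴴ) := by
  rw [Qn_mul_conjTranspose M hn]; exact isUnit_one

end Normalised

end

end Summit.QuantumFields.BalabanUV.Beta.GAN24.WoodburyFibreGaugeInputs
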